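import Summits.ABC.IUTFork.Repair.RHLevelMoverBoxFree
import Summits.ABC.IUTFork.Repair.RHSlotReach
import HarnessLib

/-!
# D-0079 RESCUE sub-cell R-H — ROW 20 «linear-reach-law»: the EXACT companion cell `HReachCell` at a one-place packet IS a kernel door
# (`HReachCell` ⟹ `qRegion (i+1) p ⊆ ⁿ˒°𝒰_{i+1,p}`), the certificates `c, B` discharged by `IsInnerConductor` / `IsOuterOrder`

PROOF-ONLY file (D-0012: 0 definitions, 0 `Prop` facts; abc-iut cell, rung LADDER-ABC:A2.RP → A2.RESCUE-H; seat abc-iut-rp-d3 gen 5, the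
LEVER named by abc-iut-rh-tst-7 19:15:56Z (iii) / 20:10:17Z for ROW 20 of R-H ROUND 1, candidate of abc-iut-lens-control-1 typed by
abc-iut-rh-typ-7 in `Repair/RHLinearReachLaw.lean` p463810). TAKES NO SIDE on [IUTchIII] Cor. 3.12 or on any author; `HReachCell` /
`HStarLinearReachLaw` are R-H CANDIDATE vocabulary = HYPOTHESIS SHAPES, never asserted; typed ≠ proved; instantiated ≠ endorsed. Inputs BY
NAME: this seat's `RHLevelMover.qRegion_subset_thetaHull_settingPrVolSharp_of_reachCell` (p465556; box-free criterion of abc-iut-w4-d087 +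
level mover p461981), rh-typ-7's `RH.LinearReachLaw.exists_isInnerConductor` / `exists_isOuterOrder` / `hReachCell_of_hStar`, rh-typ-12's
`RHSlotReach.exists_norm_le_one_not_mem_logUnits` (the unit ball is never inside `log_p(𝒪^×)`, [IUTchIV] Prop. 1.4 (ii)), campaign-S's
`norm_eq_rpow_of_isUniformizer` (`‖ϖ‖ = p^{−1/e}`).

* `qRegion_subset_thetaHull_settingPrVolSharp_of_hReachCell` — at a prime `p` carrying a UNIQUE place `x₀` of `F`, for a norm uniformizer
  `ϖ` of `K_{x₀}` and REALISING orders (`‖t_{q,x₀}‖ = ‖ϖ‖^m`, `‖t_{Θ,i+1,x₀}‖ = ‖ϖ‖^{(i+1)²m}`): `HReachCell p K_{x₀} ϖ (i+1) m ⟹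
  qRegion (i+1) p ⊆ thetaHull (i+1) p` at `settingPrVolSharp`. The inner conductor `c` EXISTS and is `≥ 1` (unit ball ⊄ `Λ`), so its
  minimality yields a non-log-unit `y` with `‖y‖ ≤ ‖ϖ‖^{c−1}`; the outer order `B` EXISTS with a witness `z ∈ Λ`, `‖z‖ = ‖ϖ‖^B`.
* `qRegion_subset_thetaHull_settingPrVolSharp_of_hStarLinearReachLaw` — the same from the LINEAR law `HStarLinearReachLaw` (row 20 AS FILED),
  via rh-typ-7's `hReachCell_of_hStar`.
HONEST SCOPE: one-place packets only (`huniq`); the labels `i+1 ∈ 𝔽_l^⋇`; OUR typed (Ind2) (Dupuy–Hilado, STRONGER-THAN-PRINT), SHARP boxes,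
hull-level Step (xi-f); «the inclusion follows from the cell AS TYPED», nothing more. [cite: DupuyHilado2025, §3.9, §4.9]
[cite: WeilBNT1967, Ch. II §2, Th. 1] [cite: Mochizuki2012, IUTchIV Prop. 1.4 (ii) p. 13; IUTchIII Cor. 3.12 Step (xi-f) p. 184]
[claim: Mochizuki2012, status: disputed]
-/

noncomputable section

open Set Function Metric
open scoped Pointwise

namespace Summit.ABC.IUTFork.Repair.RHLevelMover

open Thm311 Thm311.Real Cor312 Cor312.Setting Cor312Vol Literature.IUT.LogThetaLattice Literature.IUT.LogVolume
open Literature.NumberTheory.NumberFields NumberField IsDedekindDomain RH.LinearReachLaw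
open Literature.NumberTheory.GaloisRepresentations.Ultrametric

section Setting

variable {F : Type} [Field F] [NumberField F] (X : PilotData F) {logv : PadicLogs F} (hlog : LogvAnalytic logv)
  (M : Type) [Field M] [NumberField M]
  (archPk : ∀ (j : (thetaIndex X).Label) (vQ : (thetaIndex X).VQ), Set ((logShellsDH X logv).Packet j vQ))
  (archSub : ∀ (j : (thetaIndex X).Label) (v : (thetaIndex X).V),
    Set ((logShellsDH X logv).Packet j ((thetaIndex X).over v)))
  (Ψ : ℤ → ∀ v : (thetaIndex X).V, v ∈ (thetaIndex X).Vbad → Set ((logShellsDH X logv).StarPacket v))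
  (act : ℤ → ∀ v : (thetaIndex X).V, v ∈ (thetaIndex X).Vbad →
    (logShellsDH X logv).StarPacket v → Module.End ℚ ((logShellsDH X logv).StarPacket v))
  (Mmod : ℤ → ∀ j : (thetaIndex X).LabelStar, Set ((logShellsDH X logv).GlobalPacket j.1))
  (region : ℤ → ∀ j : (thetaIndex X).LabelStar, FinDivisor M → ∀ vQ : (thetaIndex X).VQ,
    Set ((logShellsDH X logv).Packet j.1 vQ))
  (n : ℤ) {HT : Type} {LogLink : HT → HT → Type} {IsFull : ∀ {s t : HT}, LogLink s t → Prop}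
  (lat : LGPGaussianLogThetaLattice LogLink IsFull)
  {Frd : Type} {IsoF : Frd → Frd → Type} {Ob : Frd → Type} {realify : Frd → Frd} {Strip : Type}
  {IsoS : Strip → Strip → Type} {Mv : ∀ v : (thetaIndex X).V, v ∈ (thetaIndex X).Vbad → Type}
  [∀ v h, Monoid (Mv v h)]
  (sig : GlobalLGPFrobenioidSignature (thetaIndex X).lstar (thetaIndex X).V (· ∈ (thetaIndex X).Vbad)
    Frd IsoF Ob realify Strip IsoS Mv)
  (split : SplittingMonoids Mv) {ObΔ : Type} {N : ∀ v : (thetaIndex X).V, v ∈ (thetaIndex X).Vbad → Type}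
  [∀ v h, Monoid (N v h)] (qData : QPilotData ObΔ N)
  (tq : ∀ (pp : Nat.Primes) (x : (thetaIndex X).Fibre (.inr pp)), haveI : Fact (pp : ℕ).Prime := ⟨pp.2⟩; kOf X pp.1 x)
  (t : ∀ (pp : Nat.Primes) (_ : Fin X.lstar) (x : (thetaIndex X).Fibre (.inr pp)),
    haveI : Fact (pp : ℕ).Prime := ⟨pp.2⟩; kOf X pp.1 x)
  (htq0 : ∀ pp x, tq pp x ≠ 0)
  (htq1 : ∀ (pp : Nat.Primes) (x : (thetaIndex X).Fibre (.inr pp)),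
    haveI : Fact (pp : ℕ).Prime := ⟨pp.2⟩; placeOf X pp.1 x ∉ X.S → ‖tq pp x‖ = 1)

/-- **`HReachCell` ⟹ `qRegion (i+1) p ⊆ thetaHull (i+1) p` at a prime carrying a UNIQUE place** (row 20's exact companion cell as a door;
realising orders at `x₀` in a norm uniformizer `ϖ`). [cite: DupuyHilado2025, §3.9, §4.9] [cite: WeilBNT1967, Ch. II §2, Th. 1]
[cite: Mochizuki2012, IUTchIV Prop. 1.4 (ii) p. 13] [claim: Mochizuki2012, status: disputed] -/
theorem qRegion_subset_thetaHull_settingPrVolSharp_of_hReachCell (ht0 : ∀ pp i x, t pp i x ≠ 0)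
    (pp : Nat.Primes) (v₀ : HeightOneSpectrum (𝓞 F)) (hv₀ : (thetaIndex X).over (.inr v₀) = .inr pp)
    (huniq : ∀ x : (thetaIndex X).Fibre (.inr pp), x = ⟨.inr v₀, hv₀⟩) (i : Fin (thetaIndex X).lstar) (m : ℤ)
    (ϖ : haveI : Fact (pp : ℕ).Prime := ⟨pp.2⟩; (kOf X pp.1 ⟨.inr v₀, hv₀⟩)ˣ)
    (hϖ : haveI : Fact (pp : ℕ).Prime := ⟨pp.2⟩; IsUniformizer ϖ)
    (hq : haveI : Fact (pp : ℕ).Prime := ⟨pp.2⟩; ‖tq pp ⟨.inr v₀, hv₀⟩‖ = ‖(ϖ : kOf X pp.1 ⟨.inr v₀, hv₀⟩)‖ ^ m)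
    (hΘ : haveI : Fact (pp : ℕ).Prime := ⟨pp.2⟩;
      ‖t pp i ⟨.inr v₀, hv₀⟩‖ = ‖(ϖ : kOf X pp.1 ⟨.inr v₀, hv₀⟩)‖ ^ ((((i : ℕ) + 1 : ℕ) : ℤ) ^ 2 * m))
    (hcell : haveI : Fact (pp : ℕ).Prime := ⟨pp.2⟩; HReachCell pp.1 (kOf X pp.1 ⟨.inr v₀, hv₀⟩) ϖ ((i : ℕ) + 1) m) :
    (settingPrVolSharp X hlog M archPk archSub Ψ act Mmod region n lat sig split qData tq t htq0 htq1).qRegion (Setting.labelSucc i)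
        (.inr pp) ⊆
      (settingPrVolSharp X hlog M archPk archSub Ψ act Mmod region n lat sig split qData tq t htq0 htq1).thetaHull (Setting.labelSucc i)
        (.inr pp) := by
  haveI hpF : Fact (pp : ℕ).Prime := ⟨pp.2⟩
  classical
  -- the certificates exist
  obtain ⟨c, hc⟩ := exists_isInnerConductor (p := pp.1) (K := kOf X pp.1 ⟨.inr v₀, hv₀⟩) hϖ
  obtain ⟨B, hB⟩ := exists_isOuterOrder (p := pp.1) (K := kOf X pp.1 ⟨.inr v₀, hv₀⟩) hϖ
  have hRC : ReachCell (absRamificationIdx pp.1 (kOf X pp.1 ⟨.inr v₀, hv₀⟩) : ℤ) (c : ℤ) B ((i : ℕ) + 1) m :=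
    hcell c B hc hB
  -- the inner conductor is `≥ 1`: the unit ball is not inside `log_p(𝒪^×)`
  have hc1 : 1 ≤ c := by
    by_contra h0
    have hc0 : c = 0 := by omega
    obtain ⟨u, hu1, hu⟩ := RHSlotReach.exists_norm_le_one_not_mem_logUnits pp.1 (kOf X pp.1 ⟨.inr v₀, hv₀⟩)
    refine hu (hc.1 ?_)
    rw [mem_closedBall_zero_iff, hc0, pow_zero]
    exact hu1
  -- its minimality: a non-log-unit of norm `≤ ‖ϖ‖^{c-1}`
  obtain ⟨y, hyc, hy⟩ : ∃ y : kOf X pp.1 ⟨.inr v₀, hv₀⟩,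
      ‖y‖ ≤ ‖(ϖ : kOf X pp.1 ⟨.inr v₀, hv₀⟩)‖ ^ ((c : ℤ) - 1) ∧
        y ∉ (logUnits (kOf X pp.1 ⟨.inr v₀, hv₀⟩) : Set (kOf X pp.1 ⟨.inr v₀, hv₀⟩)) := by
    have hmin : ¬ closedBall (0 : kOf X pp.1 ⟨.inr v₀, hv₀⟩) (‖(ϖ : kOf X pp.1 ⟨.inr v₀, hv₀⟩)‖ ^ (c - 1)) ⊆
        logUnits (kOf X pp.1 ⟨.inr v₀, hv₀⟩) := by
      intro hsub
      have := hc.2 (c - 1) hsub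
      omega
    obtain ⟨y, hy1, hy2⟩ := Set.not_subset.1 hmin
    refine ⟨y, ?_, hy2⟩
    rw [mem_closedBall_zero_iff] at hy1
    rwa [show ((c : ℤ) - 1) = ((c - 1 : ℕ) : ℤ) by omega, zpow_natCast]
  -- the outer order's witness
  obtain ⟨z, hz, hzB⟩ := hB.2
  -- the uniformizer's norm
  have hϖ' : ‖(ϖ : kOf X pp.1 ⟨.inr v₀, hv₀⟩)‖ =
      ((pp : ℕ) : ℝ) ^ (-(1 : ℝ) / (absRamificationIdx pp.1 (kOf X pp.1 ⟨.inr v₀, hv₀⟩) : ℝ)) := by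
    rw [norm_eq_rpow_of_isUniformizer pp.1 (kOf X pp.1 ⟨.inr v₀, hv₀⟩) hϖ, neg_div]
  exact qRegion_subset_thetaHull_settingPrVolSharp_of_reachCell X hlog M archPk archSub Ψ act Mmod region n lat sig split qData tq t
    htq0 htq1 ht0 pp v₀ hv₀ huniq i (absRamificationIdx pp.1 (kOf X pp.1 ⟨.inr v₀, hv₀⟩)) c
    (absRamificationIdx_pos pp.1 (kOf X pp.1 ⟨.inr v₀, hv₀⟩)) B m hϖ' hy hyc hz hzB.ge hq hΘ hRC

/-- **Row 20 AS FILED: `HStarLinearReachLaw` ⟹ the inclusion** at a unique-place prime and label `i+1` (realising orders in a norm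
uniformizer), via rh-typ-7's `hReachCell_of_hStar`. [cite: DupuyHilado2025, §3.9, §4.9] [claim: Mochizuki2012, status: disputed] -/
theorem qRegion_subset_thetaHull_settingPrVolSharp_of_hStarLinearReachLaw (ht0 : ∀ pp i x, t pp i x ≠ 0)
    (pp : Nat.Primes) (v₀ : HeightOneSpectrum (𝓞 F)) (hv₀ : (thetaIndex X).over (.inr v₀) = .inr pp)
    (huniq : ∀ x : (thetaIndex X).Fibre (.inr pp), x = ⟨.inr v₀, hv₀⟩) (i : Fin (thetaIndex X).lstar) (m : ℤ)
    (ϖ : haveI : Fact (pp : ℕ).Prime := ⟨pp.2⟩; (kOf X pp.1 ⟨.inr v₀, hv₀⟩)ˣ)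
    (hϖ : haveI : Fact (pp : ℕ).Prime := ⟨pp.2⟩; IsUniformizer ϖ)
    (hq : haveI : Fact (pp : ℕ).Prime := ⟨pp.2⟩; ‖tq pp ⟨.inr v₀, hv₀⟩‖ = ‖(ϖ : kOf X pp.1 ⟨.inr v₀, hv₀⟩)‖ ^ m)
    (hΘ : haveI : Fact (pp : ℕ).Prime := ⟨pp.2⟩;
      ‖t pp i ⟨.inr v₀, hv₀⟩‖ = ‖(ϖ : kOf X pp.1 ⟨.inr v₀, hv₀⟩)‖ ^ ((((i : ℕ) + 1 : ℕ) : ℤ) ^ 2 * m))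
    (hlaw : haveI : Fact (pp : ℕ).Prime := ⟨pp.2⟩; HStarLinearReachLaw pp.1 (kOf X pp.1 ⟨.inr v₀, hv₀⟩) ϖ ((i : ℕ) + 1) m) :
    (settingPrVolSharp X hlog M archPk archSub Ψ act Mmod region n lat sig split qData tq t htq0 htq1).qRegion (Setting.labelSucc i)
        (.inr pp) ⊆
      (settingPrVolSharp X hlog M archPk archSub Ψ act Mmod region n lat sig split qData tq t htq0 htq1).thetaHull (Setting.labelSucc i)
        (.inr pp) :=
  haveI : Fact (pp : ℕ).Prime := ⟨pp.2⟩
  qRegion_subset_thetaHull_settingPrVolSharp_of_hReachCell X hlog M archPk archSub Ψ act Mmod region n lat sig split qData tq t htq0 htq1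
    ht0 pp v₀ hv₀ huniq i m ϖ hϖ hq hΘ (hReachCell_of_hStar pp.1 (kOf X pp.1 ⟨.inr v₀, hv₀⟩) hlaw)

end Setting

end Summit.ABC.IUTFork.Repair.RHLevelMover

end
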